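import Mathlib

/-!
# Stub `stub_amplify` for the line `Sketch` of `LevelGradedCohnUmans.GradedDesignFamily`

The pure-arithmetic amplification step of the graded Cohn–Kleinberg–Szegedy–Umans wreath lift
([cite: CohnKleinbergSzegedyUmans2005, Thm. 7.1] and p. 12): given `t` pieces with volumes
`v i ≥ 0` whose `(s/3)`-powers out-sum a budget `B ≥ 0`, some power `N` and some set `T` of
`M` words `Fin N → Fin t` of a common type satisfy
`(M!)^(s-1) (B^N)^M < ((M!)^3 ∏_{w ∈ T} ∏_k v (w k))^(s/3)`.
Ingredients: exponential-vs-polynomial growth to choose `N`, pigeonhole over the `≤ (N+1)^t`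
types of words, and `M^M ≤ e^M M!`.
-/

noncomputable section

set_option linter.dupNamespace false

open scoped BigOperators

namespace Summit.MatrixMultiplication.MatrixMultiplication.Theorems.GradedDesignFamily

open Filter Topology

/-- Choice of the power: if `0 ≤ B < A` then `e (N+1)^t B^N < A^N` for some `N`
(exponential growth beats polynomial growth). -/
theorem amplify_exists_pow (t : ℕ) {A B : ℝ} (hB : 0 ≤ B) (hAB : B < A) :
    ∃ N : ℕ, Real.exp 1 * ((N : ℝ) + 1) ^ t * B ^ N < A ^ N := by
  have hA : 0 < A := hB.trans_lt hAB
  rcases hB.eq_or_lt with rfl | hB0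
  · exact ⟨1, by simpa using hA⟩
  · have hq0 : 0 < B / A := div_pos hB0 hA
    have hq1 : B / A < 1 := (div_lt_one hA).mpr hAB
    have hqabs : |B / A| < 1 := by rwa [abs_of_pos hq0]
    have h1 := ((tendsto_pow_const_mul_const_pow_of_abs_lt_one t hqabs).comp
      (tendsto_add_atTop_nat 1)).const_mul (Real.exp 1 / (B / A))
    rw [mul_zero] at h1
    obtain ⟨N, hN⟩ := (h1.eventually (eventually_lt_nhds zero_lt_one)).exists
    refine ⟨N, ?_⟩
    simp only [Function.comp_apply] at hN
    push_cast at hN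
    have hA' : A ≠ 0 := hA.ne'
    have hB' : B ≠ 0 := hB0.ne'
    have h2 : Real.exp 1 / (B / A) * (((N : ℝ) + 1) ^ t * (B / A) ^ (N + 1)) =
        Real.exp 1 * ((N : ℝ) + 1) ^ t * B ^ N / A ^ N := by
      rw [pow_succ, div_pow]
      field_simp
    rw [h2, div_lt_one (pow_pos hA N)] at hN
    exact hN

/-- The final numeric step: if `0 ≤ c`, `M ≠ 0` and `e c < M x` then `c^M < M! x^M`
(uses `M^M ≤ e^M M!`, i.e. `x^n / n! ≤ exp x` at `x = n = M`). -/
theorem amplify_final (M : ℕ) (hM : M ≠ 0) {x c : ℝ} (hc : 0 ≤ c)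
    (h : Real.exp 1 * c < M * x) : c ^ M < M.factorial * x ^ M := by
  have hMpos : (0 : ℝ) < M := by positivity
  have hy : Real.exp 1 * c / M < x := by
    rw [div_lt_iff₀ hMpos, mul_comm x]
    exact h
  have hy0 : 0 ≤ Real.exp 1 * c / M := by positivity
  have hpow : (Real.exp 1 * c / M) ^ M < x ^ M := pow_lt_pow_left₀ hy hy0 hM
  have hfac : (M : ℝ) ^ M ≤ Real.exp 1 ^ M * M.factorial := by
    have h' := Real.pow_div_factorial_le_exp (M : ℝ) (Nat.cast_nonneg M) M
    rw [div_le_iff₀ (by positivity)] at h'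
    rwa [Real.exp_one_pow]
  calc c ^ M = (M : ℝ) ^ M * c ^ M / (M : ℝ) ^ M := by field_simp
    _ ≤ (Real.exp 1 ^ M * M.factorial) * c ^ M / (M : ℝ) ^ M := by gcongr
    _ = M.factorial * (Real.exp 1 * c / M) ^ M := by rw [div_pow, mul_pow]; ring
    _ < M.factorial * x ^ M := by gcongr

/-- Type selection: grouping the `t^N` words `w : Fin N → Fin t` by their letter counts
(at most `(N+1)^t` types), the weight `∏ k, a (w k)` is constant on each type class, and by
pigeonhole some class `T` carries at least `(∑ i, a i)^N / (N+1)^t` of the total weight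
`(∑ i, a i)^N`. -/
theorem amplify_type (t N : ℕ) (a : Fin t → ℝ) :
    ∃ T : Finset (Fin N → Fin t),
      (∀ w ∈ T, ∀ w' ∈ T, ∏ k, a (w k) = ∏ k, a (w' k)) ∧
      (∑ i, a i) ^ N / ((N : ℝ) + 1) ^ t ≤ ∑ w ∈ T, ∏ k, a (w k) := by
  -- the type of a word: the count function of the multiset of its letters
  set typ : (Fin N → Fin t) → (Fin t → ℕ) :=
    fun w i => Multiset.count i (Finset.univ.val.map w) with htyp
  have hD : (Fintype.piFinset fun _ : Fin t => Finset.range (N + 1)).card = (N + 1) ^ t := by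
    rw [Fintype.card_piFinset, Finset.prod_const, Finset.card_range, Finset.card_univ,
      Fintype.card_fin]
  have hDne : (Fintype.piFinset fun _ : Fin t => Finset.range (N + 1)).Nonempty :=
    Fintype.piFinset_nonempty.mpr fun _ => Finset.nonempty_range_add_one
  have hmaps : ∀ w ∈ (Finset.univ : Finset (Fin N → Fin t)),
      typ w ∈ Fintype.piFinset fun _ : Fin t => Finset.range (N + 1) := by
    intro w _
    rw [Fintype.mem_piFinset]
    intro i
    rw [Finset.mem_range, Nat.lt_succ_iff]
    calc typ w i = Multiset.count i (Finset.univ.val.map w) := rfl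
      _ ≤ Multiset.card (Finset.univ.val.map w) := Multiset.count_le_card _ _
      _ = N := by rw [Multiset.card_map, Finset.card_val, Finset.card_univ, Fintype.card_fin]
  have hpos : (0 : ℝ) < ((N : ℝ) + 1) ^ t := by positivity
  have hb : (Fintype.piFinset fun _ : Fin t => Finset.range (N + 1)).card •
      ((∑ i, a i) ^ N / ((N : ℝ) + 1) ^ t) ≤ ∑ w : Fin N → Fin t, ∏ k, a (w k) := by
    rw [← Fintype.sum_pow a N, hD, nsmul_eq_mul, Nat.cast_pow, Nat.cast_add_one,
      mul_div_cancel₀ _ hpos.ne']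
  obtain ⟨μ, -, hμ⟩ := Finset.exists_le_sum_fiber_of_maps_to_of_nsmul_le_sum hmaps hDne hb
  refine ⟨_, ?_, hμ⟩
  intro w hw w' hw'
  simp only [Finset.mem_filter, Finset.mem_univ, true_and] at hw hw'
  have hww' : Finset.univ.val.map w = Finset.univ.val.map w' := by
    refine Multiset.ext.mpr fun i => ?_
    change typ w i = typ w' i
    rw [hw, hw']
  have key : ∀ u : Fin N → Fin t, ∏ k, a (u k) = ((Finset.univ.val.map u).map a).prod := by
    intro u
    rw [Finset.prod_eq_multiset_prod, Multiset.map_map]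
    rfl
  rw [key w, key w', hww']

/-- The amplification in budget-free form: if `0 ≤ B < ∑ i, a i` then for some power `N` and
some set `T` of `M` words, `(B^N)^M < M! ∏_{w ∈ T} ∏_k a (w k)`. -/
theorem amplify_core (t : ℕ) (a : Fin t → ℝ) (B : ℝ) (hB : 0 ≤ B) (hlt : B < ∑ i, a i) :
    ∃ (N : ℕ) (T : Finset (Fin N → Fin t)),
      (B ^ N) ^ T.card < T.card.factorial * ∏ w ∈ T, ∏ k, a (w k) := by
  obtain ⟨N, hN⟩ := amplify_exists_pow t hB hlt
  obtain ⟨T, hTT, hsum⟩ := amplify_type t N a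
  refine ⟨N, T, ?_⟩
  have hpos : (0 : ℝ) < ((N : ℝ) + 1) ^ t := by positivity
  have h1 : Real.exp 1 * B ^ N < (∑ i, a i) ^ N / ((N : ℝ) + 1) ^ t := by
    rw [lt_div_iff₀ hpos]
    calc Real.exp 1 * B ^ N * ((N : ℝ) + 1) ^ t = Real.exp 1 * ((N : ℝ) + 1) ^ t * B ^ N := by
          ring
      _ < (∑ i, a i) ^ N := hN
  have h2 : Real.exp 1 * B ^ N < ∑ w ∈ T, ∏ k, a (w k) := h1.trans_le hsum
  -- `T` is nonempty: pick a representative word `w₀`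
  have hTne : T.Nonempty := by
    rw [Finset.nonempty_iff_ne_empty]
    rintro rfl
    rw [Finset.sum_empty] at h2
    have : (0 : ℝ) ≤ Real.exp 1 * B ^ N := by positivity
    exact absurd h2 (not_lt.mpr this)
  obtain ⟨w₀, hw₀⟩ := hTne
  have hTx : ∀ w ∈ T, ∏ k, a (w k) = ∏ k, a (w₀ k) := fun w hw => hTT w hw w₀ hw₀
  have hsumT : ∑ w ∈ T, ∏ k, a (w k) = T.card * ∏ k, a (w₀ k) := by
    rw [Finset.sum_congr rfl hTx, Finset.sum_const, nsmul_eq_mul]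
  have hprodT : ∏ w ∈ T, ∏ k, a (w k) = (∏ k, a (w₀ k)) ^ T.card := by
    rw [Finset.prod_congr rfl hTx, Finset.prod_const]
  rw [hprodT]
  refine amplify_final T.card (Finset.card_pos.mpr ⟨w₀, hw₀⟩).ne' (pow_nonneg hB N) ?_
  rw [← hsumT]
  exact h2

/-- **Amplification step** of the graded CKSU wreath lift
[cite: CohnKleinbergSzegedyUmans2005, Thm. 7.1]: if the `(s/3)`-powers of the volumes
`v i ≥ 0` of `t` pieces out-sum the budget `B ≥ 0`, then for some power `N` and some set `T`
of `M` words the single lifted design wins strictly: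
`(M!)^(s-1) (B^N)^M < ((M!)^3 ∏_{w ∈ T} ∏_k v (w k))^(s/3)`. -/
theorem stub_amplify (t : ℕ) (s B : ℝ) (hB : 0 ≤ B) (v : Fin t → ℝ) (hv : ∀ i, 0 ≤ v i)
    (hlt : B < ∑ i, v i ^ (s / 3)) :
    ∃ (N : ℕ) (T : Finset (Fin N → Fin t)),
      ((T.card.factorial : ℝ) ^ (s - 1)) * (B ^ N) ^ T.card <
        (((T.card.factorial : ℝ) ^ 3) * ∏ w ∈ T, ∏ k, v (w k)) ^ (s / 3) := by
  obtain ⟨N, T, hcore⟩ := amplify_core t (fun i => v i ^ (s / 3)) B hB hlt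
  refine ⟨N, T, ?_⟩
  have hfac : (0 : ℝ) < T.card.factorial := Nat.cast_pos.mpr (Nat.factorial_pos _)
  have hP0 : 0 ≤ ∏ w ∈ T, ∏ k, v (w k) :=
    Finset.prod_nonneg fun w _ => Finset.prod_nonneg fun k _ => hv _
  have hP : (∏ w ∈ T, ∏ k, v (w k)) ^ (s / 3) = ∏ w ∈ T, ∏ k, v (w k) ^ (s / 3) := by
    rw [← Real.finsetProd_rpow _ _ (fun w _ => Finset.prod_nonneg fun k _ => hv _)]
    refine Finset.prod_congr rfl fun w _ => ?_
    rw [← Real.finsetProd_rpow _ _ (fun k _ => hv _)]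
  have h3 : ((T.card.factorial : ℝ) ^ 3) ^ (s / 3) =
      (T.card.factorial : ℝ) ^ (s - 1) * T.card.factorial := by
    rw [← Real.rpow_natCast_mul hfac.le]
    have : ((3 : ℕ) : ℝ) * (s / 3) = (s - 1) + 1 := by
      push_cast
      ring
    rw [this, Real.rpow_add hfac, Real.rpow_one]
  rw [Real.mul_rpow (by positivity) hP0, hP, h3, mul_assoc]
  exact mul_lt_mul_of_pos_left hcore (Real.rpow_pos_of_pos hfac _)

end Summit.MatrixMultiplication.MatrixMultiplication.Theorems.GradedDesignFamily

end
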